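import Summits.Ventures.CertifiedManyBodySolver.Observables.CanonicalResponseMonotoneInField
import Summits.Ventures.CertifiedManyBodySolver.Observables.CanonicalFloorW64W32TwoW5FloorTableSlots6
import Summits.Ventures.CertifiedManyBodySolver.Observables.CanonicalCeilingA0W64W32TwoW5K3o7SourcedRowG5o7
import HarnessLib

/-!
# FQ1(c) SECANT / SECOND-DIFFERENCE INSTANCES ON NODES — «A0 second»: class A0 = (U, n, t′) = (8, ⅞, −¼), floor edition #504 (hubbard-floor eng-1 g5; zero compute)

The A0 twin of eng-1 g4's p711709 `Observables/CanonicalResponseSecantInstancesR529.lean` (A0′ = t′ 0, #529). The certificate-free secant / concavity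
theorems are eng-1 g2's p676488 `Observables/CanonicalResponseMonotoneInField.lean` (every t′); nodes enter only through the certified floor / lid words:

* `energyDropA0_n7o8_tpm1o4_r504_g3o16_g1o4_bounds` — for translation-invariant density-⅞ MINIMISERS ω₁ of E^{−1/4}_{h₁}, h₁ = √2·3/16 (h_tree ≈ 0.26517, the lowest A0 cell of
  record whose floor word is ≥ 0.01, FL-RULING 85 (b)) and ω₂ of E^{−1/4}_{h₂}, h₂ = √2·1/4 (≈ 0.35355): **0.0028218 ≤ E_{h₁}(ω₁) − E_{h₂}(ω₂) ≤ 0.1673286** per site, from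
  `2(h₂−h₁)·m(ω₁) ≤ ΔE ≤ 2(h₂−h₁)·m(ω₂)` (p676488, t′ = −1/4) with the A0 floor of record `m(ω₁) ≥ 0.0159630` (cq `canonicalFloorA0_n7o8_A0W64W32twoW5k3o7_decimal_g3o16`,
  file `CanonicalFloorW64W32TwoW5FloorTableSlots6.lean`; nodes #504 + the DIAG-HOP readings of the 64 × 4 κ 3/7 μ* box j276038 (R5′, exact replay hubbard-floor kit j324543) ⊕ the
  32 × 4 κ 3/7 μ₀ 2 twin j269676 (R6, j323154)) and the A0 lid of record `m(ω₂) ≤ 0.9465533` (cq p708290 `canonicalCeilingA0_n7o8_tpm1o4_A0W64W32twoW5k3o7_b1_decimal_g1o4_r5o7`;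
  the SAME two diag-hop boxes + the pin-2 menu A0 row 5/7 `cert_pin2menuA0_L3_U8_tpm1o4_g5o7_E_plain_j287829`) ⇒ node premises = {#504; j276038 ⊕ j269676 (diag-hop); row 5/7 j287829}
  (4 names); exact ends 2√2·(1/16)·0.0159630 = 0.0028218863… (7 dp DOWN via √2 > 1.4142135623, maximal) and 2√2·(1/16)·0.9465533 = 0.1673285642…/0.1673285643 (7 dp UP via
  √2 < 1.4142135624, minimal).
* `secondDifferenceA0_n7o8_tpm1o4_g3o16_g1o4_g2o7` — the concavity inequality `(h₃−h₂)(E₁−E₂) ≤ (h₂−h₁)(E₂−E₃)` at the three certified A0 fields h = √2·3/16, √2·1/4, √2·2/7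
  (certificate-free specialisation of `secant_secondDifference_nonpos` at t′ = −1/4; only the three minimiser binders).

READING (pre-stated, unchanged): the bracket is [0.0028, 0.1674] wide because the A0 cells are kinematic (m⁺ − m⁻ ≥ 0.88); an arithmetic corollary of numbers of
record, NO information about the shape of m(h) below the kinematic scale — FQ1(c) «INFORMATIVE = NO» stands for A0 as for A0′.
HONEST FRAMING: statements about translation-invariant density-⅞ minimisers of the d-wave-SOURCED energy at (U, n, t′) = (8, ⅞, −¼), CONDITIONAL by name on the
listed nodes; never an onset, an order parameter, a gap or `T_c`; superconductivity in the Hubbard model is NOT proved or disproved by any of this.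
No definition; no named fact; no new node; no `sorry`. References: R. B. Griffiths, Phys. Rev. 152 (1966) 240 §II; T. Koma, H. Tasaki, J. Stat. Phys. 76 (1994) 745 §1.
-/

noncomputable section

namespace Summit.Ventures.CertifiedManyBodySolver.Observables

open Matrix Finset Literature.Probability.LatticeModels
open Literature.MathematicalPhysics.QuantumLattice Literature.MathematicalPhysics.QuantumLattice.ThermodynamicLimit
open Literature.MathematicalPhysics.QuantumLattice.TwoCluster InfVolFermionState
open Summit.Ventures.CertifiedManyBodySolver Summit.Ventures.CertifiedManyBodySolver.Certificates
open scoped ComplexOrder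

variable {ω₁ ω₂ ω₃ : InfVolFermionState 2}

/-- **CERTIFIED ENERGY-DROP BRACKET between the A0 fields `h₁ = √2·3/16` and `h₂ = √2·1/4` (t′ = −1/4, #504 floor / A0 W64 ⊕ W32 κ 3/7 lid vs row 5/7).** For
translation-invariant density-⅞ minimisers `ω₁` of `E^{−1/4}_{h₁}` and `ω₂` of `E^{−1/4}_{h₂}`: `0.0028218 ≤ E_{h₁}(ω₁) − E_{h₂}(ω₂) ≤ 0.1673286` (energies per site). Lower end =
Griffiths secant `2(h₂−h₁)·m(ω₁) ≤ ΔE` (p676488) + A0 floor `0.0159630 ≤ m(ω₁)` (cq `canonicalFloorA0_n7o8_A0W64W32twoW5k3o7_decimal_g3o16`); upper end = `ΔE ≤ 2(h₂−h₁)·m(ω₂)`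
+ A0 lid `m(ω₂) ≤ 0.9465533` (cq p708290 `canonicalCeilingA0_n7o8_tpm1o4_A0W64W32twoW5k3o7_b1_decimal_g1o4_r5o7`); `√2 ∈ (1.4142135623, 1.4142135624)`. CONDITIONAL by name on
#504, the two diag-hop κ 3/7 boxes (shared by floor and lid) and the pin-2 A0 row 5/7; an arithmetic corollary of numbers of record (kinematic width), no shape information. [cite: Griffiths1966, §II] -/
theorem energyDropA0_n7o8_tpm1o4_r504_g3o16_g1o4_bounds
    (hω₁ : ω₁.IsTranslationInvariant) (hρ₁ : ω₁.density = 7 / 8)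
    (hmin₁ : ∀ ω' : InfVolFermionState 2, ω'.IsTranslationInvariant → ω'.density = 7 / 8 →
      ω₁.meanEnergy (hubbardTTPrimeSourcedInteraction 1 (-1 / 4) 8 0 dWaveFormFactor (Real.sqrt 2 * (3 / 16 : ℝ))) 1 ≤
        ω'.meanEnergy (hubbardTTPrimeSourcedInteraction 1 (-1 / 4) 8 0 dWaveFormFactor (Real.sqrt 2 * (3 / 16 : ℝ))) 1)
    (hω₂ : ω₂.IsTranslationInvariant) (hρ₂ : ω₂.density = 7 / 8)
    (hmin₂ : ∀ ω' : InfVolFermionState 2, ω'.IsTranslationInvariant → ω'.density = 7 / 8 →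
      ω₂.meanEnergy (hubbardTTPrimeSourcedInteraction 1 (-1 / 4) 8 0 dWaveFormFactor (Real.sqrt 2 * (1 / 4 : ℝ))) 1 ≤
        ω'.meanEnergy (hubbardTTPrimeSourcedInteraction 1 (-1 / 4) 8 0 dWaveFormFactor (Real.sqrt 2 * (1 / 4 : ℝ))) 1)
    (h504 : cert_r504_bs_GU8n7o8tpm1o4_w3_b4_R2_ob5p2_kry1_kry2c3rel_hanK7B4D4_KN4_PR20d4_hanK8c2s_uprime)
    (hW₁ : cert_sgf_openbox64x4_U8_mu980464777135o549755813888_k3o7_j276038_twoFieldDiagHop) (hW₂ : cert_sgf_openbox32x4_U8_mu2_k3o7_j269676_twoFieldDiagHop)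
    (hN : cert_pin2menuA0_L3_U8_tpm1o4_g5o7_E_plain_j287829) :
    (0.0028218 : ℝ) ≤ ω₁.meanEnergy (hubbardTTPrimeSourcedInteraction 1 (-1 / 4) 8 0 dWaveFormFactor (Real.sqrt 2 * (3 / 16 : ℝ))) 1 -
        ω₂.meanEnergy (hubbardTTPrimeSourcedInteraction 1 (-1 / 4) 8 0 dWaveFormFactor (Real.sqrt 2 * (1 / 4 : ℝ))) 1 ∧
      ω₁.meanEnergy (hubbardTTPrimeSourcedInteraction 1 (-1 / 4) 8 0 dWaveFormFactor (Real.sqrt 2 * (3 / 16 : ℝ))) 1 -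
        ω₂.meanEnergy (hubbardTTPrimeSourcedInteraction 1 (-1 / 4) 8 0 dWaveFormFactor (Real.sqrt 2 * (1 / 4 : ℝ))) 1 ≤ (0.1673286 : ℝ) := by
  have hs1 : (14142135623 / 10 ^ 10 : ℝ) < Real.sqrt 2 := by rw [Real.lt_sqrt (by norm_num)]; norm_num
  have hs2 : Real.sqrt 2 < 14142135624 / 10 ^ 10 := by
    rw [Real.sqrt_lt' (by norm_num)]; norm_num
  have hA := two_mul_sub_mul_re_expect_le_secant (t' := (-1 / 4 : ℝ)) (U := (8 : ℝ)) (h₁ := Real.sqrt 2 * (3 / 16 : ℝ)) hω₁ hρ₁ hmin₂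
  have hB := secant_le_two_mul_sub_mul_re_expect (t' := (-1 / 4 : ℝ)) (U := (8 : ℝ)) (h₂ := Real.sqrt 2 * (1 / 4 : ℝ)) hω₂ hρ₂ hmin₁
  have hfloor := canonicalFloorA0_n7o8_A0W64W32twoW5k3o7_decimal_g3o16 hω₁ hρ₁ hmin₁ h504 hW₁ hW₂
  have hlid := canonicalCeilingA0_n7o8_tpm1o4_A0W64W32twoW5k3o7_b1_decimal_g1o4_r5o7 hω₂ hρ₂ hmin₂ hW₁ hW₂ hN
  have hd : 0 < Real.sqrt 2 * (1 / 4 : ℝ) - Real.sqrt 2 * (3 / 16 : ℝ) := by nlinarith [hs1]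
  constructor
  · nlinarith [mul_le_mul_of_nonneg_left hfloor hd.le, hs1]
  · nlinarith [mul_le_mul_of_nonneg_left hlid hd.le, hs2]

/-- **SECOND-DIFFERENCE (concavity) INSTANCE at the certified A0 fields `√2·3/16 < √2·1/4 < √2·2/7`** (t′ = −1/4; certificate-free specialisation of p676488's
`secant_secondDifference_nonpos`): `(h₃ − h₂)·(E_{h₁}(ω₁) − E_{h₂}(ω₂)) ≤ (h₂ − h₁)·(E_{h₂}(ω₂) − E_{h₃}(ω₃))` for translation-invariant density-⅞ minimisers
`ω₁, ω₂, ω₃` at the three fields. No node premise. [cite: Griffiths1966, §II] -/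
theorem secondDifferenceA0_n7o8_tpm1o4_g3o16_g1o4_g2o7
    (hω₂ : ω₂.IsTranslationInvariant) (hρ₂ : ω₂.density = 7 / 8)
    (hmin₁ : ∀ ω' : InfVolFermionState 2, ω'.IsTranslationInvariant → ω'.density = 7 / 8 →
      ω₁.meanEnergy (hubbardTTPrimeSourcedInteraction 1 (-1 / 4) 8 0 dWaveFormFactor (Real.sqrt 2 * (3 / 16 : ℝ))) 1 ≤
        ω'.meanEnergy (hubbardTTPrimeSourcedInteraction 1 (-1 / 4) 8 0 dWaveFormFactor (Real.sqrt 2 * (3 / 16 : ℝ))) 1)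
    (hmin₃ : ∀ ω' : InfVolFermionState 2, ω'.IsTranslationInvariant → ω'.density = 7 / 8 →
      ω₃.meanEnergy (hubbardTTPrimeSourcedInteraction 1 (-1 / 4) 8 0 dWaveFormFactor (Real.sqrt 2 * (2 / 7 : ℝ))) 1 ≤
        ω'.meanEnergy (hubbardTTPrimeSourcedInteraction 1 (-1 / 4) 8 0 dWaveFormFactor (Real.sqrt 2 * (2 / 7 : ℝ))) 1) :
    (Real.sqrt 2 * (2 / 7 : ℝ) - Real.sqrt 2 * (1 / 4 : ℝ)) *
        (ω₁.meanEnergy (hubbardTTPrimeSourcedInteraction 1 (-1 / 4) 8 0 dWaveFormFactor (Real.sqrt 2 * (3 / 16 : ℝ))) 1 -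
          ω₂.meanEnergy (hubbardTTPrimeSourcedInteraction 1 (-1 / 4) 8 0 dWaveFormFactor (Real.sqrt 2 * (1 / 4 : ℝ))) 1) ≤
      (Real.sqrt 2 * (1 / 4 : ℝ) - Real.sqrt 2 * (3 / 16 : ℝ)) *
        (ω₂.meanEnergy (hubbardTTPrimeSourcedInteraction 1 (-1 / 4) 8 0 dWaveFormFactor (Real.sqrt 2 * (1 / 4 : ℝ))) 1 -
          ω₃.meanEnergy (hubbardTTPrimeSourcedInteraction 1 (-1 / 4) 8 0 dWaveFormFactor (Real.sqrt 2 * (2 / 7 : ℝ))) 1) := by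
  have hs : 0 < Real.sqrt 2 := Real.sqrt_pos.2 (by norm_num)
  exact secant_secondDifference_nonpos (t' := (-1 / 4 : ℝ)) (U := (8 : ℝ)) (by nlinarith [hs]) (by nlinarith [hs]) hω₂ hρ₂ hmin₁ hmin₃

end Summit.Ventures.CertifiedManyBodySolver.Observables

end
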